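import Mathlib
import Summits.Ventures.HodgeRepro2.Tier7.Line1.SepActH10

/-!
# Tier7/Line1/SepMultOne — (H9) semisimplicity and (H10) multiplicity one for the separating datum

The SEPARATING DATUM of t7-L1-p2 (LINE L1, residual probe). From the classification `heckeStable_cases` of
`SepActH10`: every Hecke-stable subspace of `H10 * H10` has a Hecke-stable complement and, if non-zero, contains a
Hecke-irreducible subspace (`H20_semisimple'`); the Hecke-irreducible subspaces of `H10 * H10` are exactly `ι(P_A)`
and `ι(P_B)` (`heckeIrred_cases`), and a non-zero equivariant map between two of them forces equality because
`Hom(P_A, P_B) = Hom(P_B, P_A) = 0` (`SepModule.hom_zero_to_sq` / `hom_sq_to_zero`) — `H20_multone'`, in the exact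
shape of the fields of `SurfaceShadow` (frozen `Target.lean`). Author: t7-L1-p2
(prover-pub-hodge-repro2-t7-L1-p2-g0-0). §8(d): NO.
-/

namespace Summit.Ventures.HodgeRepro2.Tier7.Line1.Sep

open Finset Summit.Ventures.HodgeRepro2.Tier7

noncomputable section

variable {J : Type} [AddCommGroup J] [Module ℂ J]

/-! ## The irreducibles of `H10 * H10` -/

/-- `ι(PW 0) ≠ H10 * H10` -/
theorem map_PW_zero_ne_mul : (PW 0).map (ι (J := J)) ≠ H10 * H10 := by
  intro h
  apply PW_zero_ne_top
  rw [H10_mul_H10, LinearMap.range_eq_map] at h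
  have := congrArg (Submodule.comap (ι (J := J))) h
  rwa [Submodule.comap_map_eq_of_injective ι_injective, Submodule.comap_map_eq_of_injective ι_injective]
    at this

/-- `H10 * H10` is not Hecke-irreducible -/
theorem not_heckeIrred_mul : ¬ HeckeIrred G ((H10 : Submodule ℂ (HXS J)) * H10) := by
  intro h
  rcases h.2.2 _ (map_PW_le 0) (heckeStable_map_PW 0) with h0 | h0
  · exact map_PW_ne_bot 0 Wmod_zero_le_Usub h0
  · exact map_PW_zero_ne_mul h0

/-- the Hecke-irreducible subspaces of `H10 * H10` are `ι(P_A)` and `ι(P_B)` -/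
theorem heckeIrred_cases {U : Submodule ℂ (HXS J)} (hle : U ≤ H10 * H10) (hU : HeckeIrred G U) :
    U = (PW 0).map ι ∨ U = (PW sq).map ι := by
  rcases heckeStable_cases hle hU.2.1 with h | h | h | h
  · exact absurd h hU.1
  · exact Or.inl h
  · exact Or.inr h
  · exact absurd (h ▸ hU) not_heckeIrred_mul

/-- `H10 * H10` is Hecke-stable -/
theorem heckeStable_mul : HeckeStable G ((H10 : Submodule ℂ (HXS J)) * H10) := by
  rw [H10_mul_H10, heckeStable_iff_stableM le_rfl]
  have : (LinearMap.range (ι (J := J))).comap ι = ⊤ := by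
    rw [LinearMap.range_eq_map, Submodule.comap_map_eq_of_injective ι_injective]
  rw [this]
  exact ⟨fun _ _ _ => Submodule.mem_top, fun _ _ _ => Submodule.mem_top, fun _ _ => Submodule.mem_top,
    fun _ _ => Submodule.mem_top⟩

/-- the two irreducibles are independent -/
theorem map_PW_inf : (PW 0).map (ι (J := J)) ⊓ (PW sq).map ι = ⊥ := by
  rw [← Submodule.map_inf _ ι_injective, PW_zero_inf_PW_sq, Submodule.map_bot]

/-- the two irreducibles span `H10 * H10` -/
theorem map_PW_sup : (PW 0).map (ι (J := J)) ⊔ (PW sq).map ι = H10 * H10 := by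
  rw [← Submodule.map_sup, PW_zero_sup_PW_sq, Submodule.map_top, H10_mul_H10]

/-- (H9) SEMISIMPLICITY of `H10 * H10`, in the shape of `SurfaceShadow.H20_semisimple` -/
theorem H20_semisimple' (U : Submodule ℂ (HXS J)) (hle : U ≤ H10 * H10) (hU : HeckeStable G U) :
    (∃ U' : Submodule ℂ (HXS J), U' ≤ H10 * H10 ∧ HeckeStable G U' ∧ U ⊓ U' = ⊥ ∧ U ⊔ U' = H10 * H10) ∧
    (U ≠ ⊥ → ∃ W : Submodule ℂ (HXS J), W ≤ U ∧ HeckeIrred G W) := by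
  rcases heckeStable_cases hle hU with rfl | rfl | rfl | rfl
  · exact ⟨⟨H10 * H10, le_rfl, heckeStable_mul, bot_inf_eq _, bot_sup_eq _⟩, fun h => absurd rfl h⟩
  · exact ⟨⟨(PW sq).map ι, map_PW_le sq, heckeStable_map_PW sq, map_PW_inf, map_PW_sup⟩,
      fun _ => ⟨_, le_rfl, heckeIrred_map_PW 0 Wmod_zero_le_Usub⟩⟩
  · refine ⟨⟨(PW 0).map ι, map_PW_le 0, heckeStable_map_PW 0, ?_, ?_⟩,
      fun _ => ⟨_, le_rfl, heckeIrred_map_PW sq Wmod_sq_le_Usub⟩⟩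
    · rw [inf_comm]; exact map_PW_inf
    · rw [sup_comm]; exact map_PW_sup
  · exact ⟨⟨⊥, bot_le, fun g a ha => by
        rw [Submodule.mem_bot] at ha ⊢; rw [ha, smul_def]; exact map_zero _, inf_bot_eq _, sup_bot_eq _⟩,
      fun _ => ⟨(PW 0).map ι, map_PW_le 0, heckeIrred_map_PW 0 Wmod_zero_le_Usub⟩⟩

/-! ## Equivariant maps between the irreducibles -/

/-- the inclusion `PW s → ι(PW s)` -/
def incPW (s : ℕ → ℂ) : ↥(PW s) →ₗ[ℂ] ↥((PW s).map (ι (J := J))) :=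
  LinearMap.codRestrict _ (ι.comp (PW s).subtype) fun x => Submodule.mem_map_of_mem x.2

/-- `incPW` unfolded -/
@[simp] theorem incPW_apply_coe (s : ℕ → ℂ) (x : PW s) : ((incPW (J := J) s x : ↥((PW s).map ι)) : HXS J) = ι x :=
  rfl

/-- `incPW` is surjective -/
theorem incPW_surjective (s : ℕ → ℂ) : Function.Surjective (incPW (J := J) s) := by
  rintro ⟨_, x, hx, rfl⟩
  exact ⟨⟨x, hx⟩, rfl⟩

/-- the preimage of an equivariant map `ι(PW s) → ι(PW s')` on the model -/
def pullback {s s' : ℕ → ℂ} (φ : ↥((PW s).map (ι (J := J))) →ₗ[ℂ] HXS J)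
    (hmem : ∀ x, φ x ∈ (PW s').map ι) : ↥(PW s) →ₗ[ℂ] M :=
  (LinearEquiv.ofInjective ι ι_injective).symm.toLinearMap.comp
    (LinearMap.codRestrict _ (φ.comp (incPW s)) fun x => LinearMap.map_le_range (hmem (incPW s x)))

/-- `ι ∘ pullback = φ ∘ incPW` -/
theorem ι_pullback {s s' : ℕ → ℂ} (φ : ↥((PW s).map (ι (J := J))) →ₗ[ℂ] HXS J)
    (hmem : ∀ x, φ x ∈ (PW s').map ι) (x : PW s) : ι (pullback φ hmem x) = φ (incPW s x) := by
  have h := LinearEquiv.apply_symm_apply (LinearEquiv.ofInjective ι ι_injective)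
    (LinearMap.codRestrict _ (φ.comp (incPW s)) (fun x => LinearMap.map_le_range (hmem (incPW s x))) x)
  have h2 := congrArg Subtype.val h
  rw [LinearEquiv.ofInjective_apply] at h2
  exact h2

/-- the pullback lands in `PW s'` -/
theorem pullback_mem {s s' : ℕ → ℂ} (φ : ↥((PW s).map (ι (J := J))) →ₗ[ℂ] HXS J)
    (hmem : ∀ x, φ x ∈ (PW s').map ι) (x : PW s) : pullback φ hmem x ∈ PW s' := by
  obtain ⟨y, hy, hyx⟩ := Submodule.mem_map.1 (hmem (incPW s x))
  rw [← ι_pullback φ hmem] at hyx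
  rwa [← ι_injective hyx]

/-- the pullback of an equivariant map commutes with a generator of `M` -/
theorem pullback_genM {s s' : ℕ → ℂ} (φ : ↥((PW s).map (ι (J := J))) →ₗ[ℂ] HXS J)
    (hmem : ∀ x, φ x ∈ (PW s').map ι)
    (heq : ∀ (g : G) (x : ↥((PW s).map ι)), φ ⟨g • (x : HXS J), heckeStable_map_PW s g x.1 x.2⟩ = g • φ x)
    (t : Bool × Option ℕ) (x : PW s) (hx : genM t x ∈ PW s) :
    pullback φ hmem ⟨genM t x, hx⟩ = genM t (pullback φ hmem x) := by
  apply ι_injective (J := J)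
  have e : incPW (J := J) s ⟨genM t x, hx⟩ =
      ⟨FreeGroup.of t • (ι x : HXS J), heckeStable_map_PW s _ _ (incPW s x).2⟩ :=
    Subtype.ext (by simp only [incPW_apply_coe, smul_ι, of_smul_M])
  rw [ι_pullback, e]
  have h := heq (FreeGroup.of t) (incPW s x)
  simp only [incPW_apply_coe] at h
  rw [h, ← ι_pullback φ hmem, smul_ι, of_smul_M]

/-- an equivariant map `ι(PW 0) → ι(PW sq)` vanishes -/
theorem eq_zero_of_zero_to_sq (φ : ↥((PW 0).map (ι (J := J))) →ₗ[ℂ] HXS J)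
    (hmem : ∀ x, φ x ∈ (PW sq).map ι)
    (heq : ∀ (g : G) (x : ↥((PW 0).map ι)), φ ⟨g • (x : HXS J), heckeStable_map_PW 0 g x.1 x.2⟩ = g • φ x) :
    φ = 0 := by
  have h0 : ∀ x, pullback φ hmem x = 0 :=
    hom_zero_to_sq (pullback φ hmem) (pullback_mem φ hmem)
      (fun n x => pullback_genM φ hmem heq (false, some n) x _)
      (fun n x => pullback_genM φ hmem heq (true, some n) x _)
  refine LinearMap.ext fun y => ?_
  obtain ⟨x, rfl⟩ := incPW_surjective 0 y
  rw [← ι_pullback φ hmem, h0, map_zero, LinearMap.zero_apply]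

/-- an equivariant map `ι(PW sq) → ι(PW 0)` vanishes -/
theorem eq_zero_of_sq_to_zero (φ : ↥((PW sq).map (ι (J := J))) →ₗ[ℂ] HXS J)
    (hmem : ∀ x, φ x ∈ (PW 0).map ι)
    (heq : ∀ (g : G) (x : ↥((PW sq).map ι)), φ ⟨g • (x : HXS J), heckeStable_map_PW sq g x.1 x.2⟩ = g • φ x) :
    φ = 0 := by
  have h0 : ∀ x, pullback φ hmem x = 0 :=
    hom_sq_to_zero (pullback φ hmem) (pullback_mem φ hmem)
      (fun n x => pullback_genM φ hmem heq (false, some n) x _)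
      (fun n x => pullback_genM φ hmem heq (true, some n) x _)
  refine LinearMap.ext fun y => ?_
  obtain ⟨x, rfl⟩ := incPW_surjective sq y
  rw [← ι_pullback φ hmem, h0, map_zero, LinearMap.zero_apply]

/-- (H10) MULTIPLICITY ONE for `H10 * H10`, in the shape of `SurfaceShadow.H20_multone` -/
theorem H20_multone' (U U' : Submodule ℂ (HXS J)) (hle : U ≤ H10 * H10) (hle' : U' ≤ H10 * H10)
    (hU : HeckeIrred G U) (hU' : HeckeIrred G U') (φ : U →ₗ[ℂ] HXS J) (hmem : ∀ x : U, φ x ∈ U')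
    (heq : ∀ (g : G) (x : U), φ ⟨g • (x : HXS J), hU.2.1 g x x.2⟩ = g • φ x) (hne : φ ≠ 0) : U = U' := by
  rcases heckeIrred_cases hle hU with rfl | rfl <;> rcases heckeIrred_cases hle' hU' with rfl | rfl
  · rfl
  · exact absurd (eq_zero_of_zero_to_sq φ hmem heq) hne
  · exact absurd (eq_zero_of_sq_to_zero φ hmem heq) hne
  · rfl

end

end Summit.Ventures.HodgeRepro2.Tier7.Line1.Sep
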